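import Summits.BirchSwinnertonDyer.BirchSwinnertonDyer.Theorems.ResidualThetaTransportAtTwoThetaLayerLambdaCongruenceAtTwoCuspSpanTriangleNEntries
import Summits.BirchSwinnertonDyer.BirchSwinnertonDyer.Theorems.ResidualThetaTransportAtTwoThetaLayerLambdaCongruenceAtTwoCuspSpanTriangleNHensel
import Summits.BirchSwinnertonDyer.BirchSwinnertonDyer.Theorems.ResidualThetaTransportAtTwoThetaLayerLambdaCongruenceAtTwoCuspSpanTriangleNAuxPrime
import HarnessLib

/-!
# Route `ResidualThetaTransportAtTwo`, cruxes Kan⁺ (stmt-BirchSwinnertonDyer-20688) / 21437, node `CuspSpanEvenAtTwo N`: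
# the THREE-FOLD `B₁`-PRODUCT RELATION `F(u) + F(v) + F(4^K/(uv)) = 0` at an ARBITRARY ODD LEVEL `N`

Cell `bsd-wall`, width seat `bsd-wall-rtt-p3-w4` g2 (2026-08-28), lane «3-fold B₁-products at prime-power and composite level»
(the device is `bsd-wall-rtt-p3-w2` g4's «q-adic triangles», there at prime level). THEOREMS ONLY;
`--supports stmt-BirchSwinnertonDyer-20688`; BSD is not proved by this.

`chi_add_chi_add_chi_eq_zero_levelN`: let `N` be odd, `χ : Γ₀(N) → 𝔽₂` additive, killing the elements of trace `0, ±1, ±2` and the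
elements with lower-right entry `±4^K` (`K ≥ 1`). Let `β₁, β₂` be `b = −1` elements with `d`-residues `u, v`, and assume
`u ≢ 1 (mod ℓ)` for every prime `ℓ ∣ N`. Then there is `K ≥ 1` such that `χ β₁ + χ β₂ + χ β₃ = 0` for EVERY `b = −1` element `β₃`
with `u v d(β₃) ≡ 4^K (mod N)` — in terms of the `B₁`-character: `F(u) + F(v) + F(4^K/(uv)) = 0`.
CONSTRUCTION (Dirichlet + CRT + quadratic reciprocity + Hensel, no conjecture): `q` prime, `q ≡ 3 (4)`, `q ≡ −uv (N)`; the auxiliary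
prime `n ≡ u (N)`, `n ≡ −1 (4 q^e R)` of `…TriangleNAuxPrime` (`(q/n) = +1`, so `m := ord_n q ∣ (n−1)/2` is prime to `ord_N q`);
`t ≥ 1` with `m ∣ t`, `t ≡ 1 (ord_N q)`; `s := (1 − q^t)/n`, `D := ns − 1 = −q^t ≡ uv`; `α₁ ≡ 1/n`, `δ₂ := s − α₁ ≡ v`, `α₂ ≡ 1/v`;
`K ≥ 1` with `q^t ∣ 4^K + n` (`…TriangleNHensel`, as `n ≡ −1 (q^e)`), `q^t w = 4^K + n`, `δ₃ := −w − α₂`: then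
`−n + D(α₂ + δ₃) = 4^K`, and `…TriangleNEntries.chi_add_chi_add_chi_eq_zero_of_witness'` applies. At PRIME-POWER level the hypothesis
reads `u ≢ 1 (mod p)` and 4-invariance (`…CuspSpanFourInvariancePrimePow`) turns the relation into `F(u) + F(v) = F(−uv)` — sequel
`…CuspSpanPrimePowNode`.

References: [Rademacher1929] §1; [IrelandRosen1990] Ch. 4–5; [Pollack2003] Conj. 6.3; Dirichlet / Mathlib `PrimesInAP`.
-/

set_option autoImplicit false
set_option linter.dupNamespace false

open scoped MatrixGroups

open CongruenceSubgroup

namespace Summit.BirchSwinnertonDyer.BirchSwinnertonDyer.Theorems.SignedMuAtTwo.TriangleN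

variable {N : ℕ} {χ : Gamma0 N → ZMod 2}

/-- `4` is prime to an odd `N` (integer form). [folklore] -/
theorem isCoprime_four_of_odd (hN : Odd N) : IsCoprime (4 : ℤ) N := by
  have h : Nat.Coprime 4 N := by
    rw [show (4 : ℕ) = 2 ^ 2 by norm_num]
    exact Nat.Coprime.pow_left _ (Nat.coprime_two_left.mpr hN)
  have := Nat.isCoprime_iff_coprime.mpr h
  exact_mod_cast this

/-- **The three-fold relation at an arbitrary odd level.** See the module docstring. [cite: Pollack2003, Conj. 6.3] -/
theorem chi_add_chi_add_chi_eq_zero_levelN [NeZero N] (hN : Odd N)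
    (hadd : ∀ γ δ : Gamma0 N, χ (γ * δ) = χ γ + χ δ)
    (hsmall : ∀ γ : Gamma0 N, ((γ : SL(2, ℤ)) 0 0 + (γ : SL(2, ℤ)) 1 1).natAbs ≤ 2 → χ γ = 0)
    (hkill : ∀ γ : Gamma0 N, (∃ k : ℕ, 1 ≤ k ∧ ((γ : SL(2, ℤ)) 1 1).natAbs = 4 ^ k) → χ γ = 0)
    {β₁ β₂ : Gamma0 N} (hb1 : (β₁ : SL(2, ℤ)) 0 1 = -1) (hb2 : (β₂ : SL(2, ℤ)) 0 1 = -1)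
    (hu1 : ∀ ℓ : ℕ, ℓ.Prime → ℓ ∣ N → ((((β₁ : SL(2, ℤ)) 1 1 : ℤ) : ZMod ℓ)) ≠ 1) :
    ∃ K : ℕ, 1 ≤ K ∧ ∀ β₃ : Gamma0 N, (β₃ : SL(2, ℤ)) 0 1 = -1 →
      ((((β₁ : SL(2, ℤ)) 1 1 : ℤ) : ZMod N)) * ((((β₂ : SL(2, ℤ)) 1 1 : ℤ) : ZMod N)) *
        ((((β₃ : SL(2, ℤ)) 1 1 : ℤ) : ZMod N)) = 4 ^ K → χ β₁ + χ β₂ + χ β₃ = 0 := by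
  classical
  have hN1 : 1 ≤ N := hN.pos
  set u : ZMod N := ((((β₁ : SL(2, ℤ)) 1 1 : ℤ) : ZMod N)) with hu_def
  set v : ZMod N := ((((β₂ : SL(2, ℤ)) 1 1 : ℤ) : ZMod N)) with hv_def
  have huu : IsUnit u := isUnit_gamma0_apply_one_one β₁
  have hvu : IsUnit v := isUnit_gamma0_apply_one_one β₂
  have hcu : IsUnit (-(u * v)) := (huu.mul hvu).neg
  -- Step 1: the prime `q ≡ 3 (mod 4)`, `q ≡ −uv (mod N)`
  set c₀ : ℕ := (-(u * v)).val with hc₀_def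
  have hc₀cop : Nat.Coprime c₀ N := by
    have h := ZMod.val_coe_unit_coprime hcu.unit
    rwa [IsUnit.unit_spec] at h
  have hc₀cast : (c₀ : ZMod N) = -(u * v) := ZMod.natCast_zmod_val _
  obtain ⟨q, -, hq, hq4, hqc⟩ := exists_prime_modEq_pair 4 N c₀ 0 (by norm_num) hN1
    (by rw [show (4 : ℕ) = 2 ^ 2 by norm_num]; exact Nat.Coprime.pow_left _ (Nat.coprime_two_left.mpr hN)) hc₀cop
  have hq2 : q ≠ 2 := by
    intro h; subst h; simp [Nat.ModEq] at hq4
  have hqN : Nat.Coprime q N := by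
    unfold Nat.Coprime; rw [hqc.gcd_eq]; exact hc₀cop
  have hqcast : (q : ZMod N) = -(u * v) := by rw [← hc₀cast]; exact (ZMod.natCast_eq_natCast_iff _ _ _).mpr hqc
  -- the unit `q` mod `N` and its order
  set qU : (ZMod N)ˣ := ZMod.unitOfCoprime q hqN with hqU_def
  set O : ℕ := orderOf (q : ZMod N) with hO_def
  have hOU : orderOf qU = O := by rw [hO_def, ← ZMod.coe_unitOfCoprime q hqN, orderOf_units]
  have hO1 : 1 ≤ O := by rw [← hOU]; exact (isOfFinOrder_of_finite qU).orderOf_pos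
  -- Step 2: the auxiliary prime `n ≡ u (mod N)`
  set ut : ℕ := u.val with hut_def
  have hutcop : Nat.Coprime ut N := by
    have h := ZMod.val_coe_unit_coprime huu.unit
    rwa [IsUnit.unit_spec] at h
  have hutcast : (ut : ZMod N) = u := ZMod.natCast_zmod_val _
  have hu1' : ∀ ℓ : ℕ, ℓ.Prime → ℓ ∣ N → ℓ ∣ orderOf (q : ZMod N) → ¬ ut ≡ 1 [MOD ℓ] := by
    intro ℓ hℓ hℓN _ hmod
    apply hu1 ℓ hℓ hℓN
    have e1 : ((ut : ℕ) : ZMod ℓ) = 1 := by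
      have := (ZMod.natCast_eq_natCast_iff _ _ _).mpr hmod
      rwa [Nat.cast_one] at this
    have e2 : ZMod.castHom hℓN (ZMod ℓ) u = ((((β₁ : SL(2, ℤ)) 1 1 : ℤ) : ZMod ℓ)) := by
      rw [hu_def, map_intCast]
    rw [← e2, ← hutcast, map_natCast, e1]
  obtain ⟨n, hnq, hn, hnu, hqe, hn4, hncop⟩ := exists_aux_prime N q ut q hN hq hq2 hqN hutcop hu1'
  have hncast : (n : ZMod N) = u := by rw [← hutcast]; exact (ZMod.natCast_eq_natCast_iff _ _ _).mpr hnu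
  have hq1n : q ∣ n + 1 :=
    (dvd_pow_self q (by have := (one_le_padicValNat_four_pow_sub_one hq hq2).2; omega)).trans hqe
  -- Step 3: `ord_n(q) ∣ (n−1)/2`, prime to `O`
  obtain ⟨hpow, hmdvd⟩ := pow_half_pred_eq_one_of_prime hn hq hq2 hn4 hq1n
  set m : ℕ := orderOf (q : ZMod n) with hm_def
  have hm1 : 1 ≤ m := by
    have hfin : IsOfFinOrder (q : ZMod n) := isOfFinOrder_iff_pow_eq_one.mpr ⟨(n - 1) / 2, by omega, hpow⟩
    exact hfin.orderOf_pos
  have hmO : Nat.Coprime m O := Nat.Coprime.coprime_dvd_left hmdvd hncop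
  -- Step 4: the exponent `t`
  obtain ⟨t, ht1, hmt, htO⟩ := exists_exponent m O hm1 hO1 hmO
  have hqtn : (q : ZMod n) ^ t = 1 := by
    obtain ⟨j, rfl⟩ := hmt
    rw [pow_mul, hm_def, pow_orderOf_eq_one, one_pow]
  have hqtN : (q : ZMod N) ^ t = q := by
    have e : qU ^ t = qU ^ 1 := pow_eq_pow_iff_modEq.mpr (hOU ▸ htO)
    have e' := congrArg (fun x : (ZMod N)ˣ ↦ (x : ZMod N)) e
    simp only [Units.val_pow_eq_pow_val, pow_one] at e'
    rwa [hqU_def, ZMod.coe_unitOfCoprime] at e'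
  -- Step 5: the integers
  obtain ⟨s₀, hs₀⟩ : (n : ℤ) ∣ (q : ℤ) ^ t - 1 := by
    rw [← ZMod.intCast_zmod_eq_zero_iff_dvd]; push_cast; rw [hqtn, sub_self]
  haveI : NeZero N := inferInstance
  have hncop : IsCoprime (n : ℤ) (N : ℤ) := by
    have h1 : Nat.Coprime n N := by unfold Nat.Coprime; rw [hnu.gcd_eq]; exact hutcop
    exact Nat.isCoprime_iff_coprime.mpr h1
  obtain ⟨α₁, b₁, hα₁⟩ := hncop
  set s : ℤ := -s₀ with hs_def
  have hns : (n : ℤ) * s - 1 = -(q : ℤ) ^ t := by rw [hs_def]; linear_combination hs₀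
  -- `s − α₁ ≡ v`
  have hα₁cast : (α₁ : ZMod N) * u = 1 := by
    have := congrArg (Int.cast : ℤ → ZMod N) hα₁
    push_cast at this
    rw [ZMod.natCast_self, mul_zero, add_zero, hncast] at this
    exact this
  have hδ₂ : ((s - α₁ : ℤ) : ZMod N) = v := by
    have e1 : (n : ZMod N) * (s : ZMod N) - 1 = -((q : ZMod N) ^ t) := by
      have := congrArg (Int.cast : ℤ → ZMod N) hns
      push_cast at this
      exact this
    rw [hqtN, hqcast, hncast] at e1
    -- `u s = 1 + u v`, `α₁ u = 1` ⟹ `u (s − α₁) = u v`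
    have e2 : u * ((s : ZMod N) - (α₁ : ZMod N)) = u * v := by linear_combination e1 - hα₁cast
    push_cast
    exact huu.mul_left_cancel e2
  have hδ₂cop : IsCoprime (s - α₁) (N : ℤ) := by
    have hvu' : IsUnit (((s - α₁ : ℤ)) : ZMod N) := by rw [hδ₂]; exact hvu
    exact ((ZMod.coe_int_isUnit_iff_isCoprime _ N).mp hvu').symm
  obtain ⟨α₂, b₂, hα₂⟩ := hδ₂cop
  -- Hensel: `q^t ∣ 4^K + n`
  obtain ⟨K, hK1, w, hw⟩ := exists_four_pow_add_dvd hq hq2 t n hqe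
  set δ₃ : ℤ := -w - α₂ with hδ₃_def
  have hfinal : -(n : ℤ) + ((n : ℤ) * s - 1) * (α₂ + δ₃) = 1 * 4 ^ K := by
    rw [hns, hδ₃_def]; linear_combination -hw
  refine ⟨K, hK1, fun β₃ hb3 h3 ↦ ?_⟩
  refine chi_add_chi_add_chi_eq_zero_of_witness' (isCoprime_four_of_odd hN) hadd hsmall hkill hb1 hb2 hb3
    (n : ℤ) s α₁ α₂ δ₃ 1 K hK1 (Or.inl rfl) ?_ ?_ ?_ ?_ ?_ hfinal
  · rw [← hu_def, ← hncast]; push_cast; rfl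
  · rw [← hv_def, hδ₂]
  · rw [h3]; push_cast; ring
  · exact ⟨b₁, by linear_combination -hα₁⟩
  · exact ⟨b₂, by linear_combination -hα₂⟩

end Summit.BirchSwinnertonDyer.BirchSwinnertonDyer.Theorems.SignedMuAtTwo.TriangleN
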